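import Literature.Computability.AlgebraicComplexity.TensorMumfordStability
import Literature.Computability.AlgebraicComplexity.TensorInvariantSeparation
import Literature.Computability.AlgebraicComplexity.BI17TensorLieStabilizerBadLocus
import Literature.Computability.AlgebraicComplexity.BI17TensorGenericTrivialStabilizer
import HarnessLib

/-!
# Generic polystability of 3-tensors from one stable tensor per format

Assembly of Bürgisser–Ikenmeyer 2017 Prop. 4.10 ("almost all `w ∈ ⊗³ℂ^m` are polystable") and of
the typed Popov-1970 criterion `Popov1970_genericClosedOrbit_tensor`, MODULO the exhibition, for each
`m ≥ 3`, of ONE tensor `w₀ ∈ ⊗³ℂ^m` which is polystable (`IsPolystableTensor`: closed `SL_m^3`-orbit)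
and has zero traceless infinitesimal stabilizer (`HasTrivialSL3LieStabilizer`; together: `w₀` is
STABLE in Mumford's sense — closed orbit, finite stabilizer,
`finite_slStabilizer_of_hasTrivialSL3LieStabilizer`). The route is Mumford's (GIT Ch. 1 §2, Ch. 4 §2),
not Popov's:

1. the bad locus `B = {w | ¬ HasTrivialSL3LieStabilizer w}` is the zero set of polynomials (maximal
   minors of the infinitesimal-action matrix) and is `SL³`-stable
   (`exists_setOf_not_hasTrivialSL3LieStabilizer_iff`, `not_hasTrivialSL3LieStabilizer_actTensor`,
   `BI17TensorLieStabilizerBadLocus.lean`);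
2. the closed orbit `SL³·w₀` and `B` are disjoint `SL³`-stable Zariski-closed sets, so an
   `SL³`-invariant `q` with `q(w₀) = 1`, `q|_B = 0` exists (Reynolds operator + Nullstellensatz,
   `IsPolystableTensor.exists_isSL3Invariant_ne_zero_of_not`, `TensorInvariantSeparation.lean`);
3. every `w` with `q(w) ≠ 0` is polystable (`q` constant on orbit closures + the compactness half of
   the Hilbert–Mumford/Kempf–Ness argument: `isZariskiGenericTensor_isPolystableTensor_of_sl3Invariant`,
   `TensorMumfordStability.lean`, `TripleOrbitClosedOfNoFixedTorus.lean`).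

Main statements: `isZariskiGenericTensor_isPolystableTensor_of_exists_stable` (any finite nonempty
index type), `BI2017_prop_4_10_of_exists_stable`, `Popov1970_genericClosedOrbit_tensor_of_exists_stable`,
`BI2017_cor_5_12_of_exists_stable` (with the tree's `BI2017_thm_4_2_holds` through
`BI2017_cor_5_12_of_thm_4_2_of_prop_4_10`); `m ≤ 2` from `BI17Prop410OfPopov.lean` /
`BI17GenericPeriodTwoProofs.lean`. The stable witnesses themselves (an explicit sparse tensor for
every `m ≥ 3`) are supplied by a separate file of the programme; this file is their consumer.

Theorem-only file (no definitions, no named facts). Honest framing: classical invariant theory;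
nothing here bears on VP versus VNP.

## References

* P. Bürgisser, C. Ikenmeyer, *Fundamental invariants of orbit closures*, J. Algebra 477 (2017),
  §4.1–4.2, Prop. 4.10, Cor. 5.12. [BurgisserIkenmeyer2017]
* D. Mumford, J. Fogarty, F. Kirwan, *Geometric Invariant Theory*, 3rd ed. (1994), Ch. 1 §2
  Cor. 1.2, Ch. 4 §2 Prop. 4.2. [MumfordFogartyKirwan1994]
* V. L. Popov, *Stability criteria for the action of a semisimple group on a factorial manifold*,
  Izv. Akad. Nauk SSSR 34 (1970), 523–531. [Popov1970]
-/

noncomputable section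

open MvPolynomial

namespace Literature.Computability.AlgebraicComplexity

section OfStable

variable {ι : Type*} [Fintype ι] [DecidableEq ι]

/-- **A separating invariant from one stable tensor.** If `w₀ ∈ ⊗³ℂ^ι` is polystable with zero
traceless infinitesimal stabilizer, there is a nonzero `SL³`-invariant polynomial function vanishing
on every tensor with non-zero traceless infinitesimal stabilizer (Reynolds separation of the closed
orbit `SL³·w₀` from the Zariski-closed `SL³`-stable bad locus; GIT Ch. 1 §2 Cor. 1.2).
[cite: MumfordFogartyKirwan1994, Ch. 1 §2 Cor. 1.2] [cite: BurgisserIkenmeyer2017, Prop. 4.10] -/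
theorem exists_isSL3Invariant_ne_zero_of_stable [Nonempty ι] {w₀ : ι → ι → ι → ℂ}
    (hw₀ : IsPolystableTensor w₀) (h₀ : HasTrivialSL3LieStabilizer w₀) :
    ∃ q : MvPolynomial (ι × ι × ι) ℂ, IsSL3Invariant q ∧ q ≠ 0 ∧
      ∀ w : ι → ι → ι → ℂ, ¬ HasTrivialSL3LieStabilizer w → aeval (tensorPt w) q = 0 :=
  hw₀.exists_isSL3Invariant_ne_zero_of_not (P := fun w => HasTrivialSL3LieStabilizer w)
    exists_setOf_not_hasTrivialSL3LieStabilizer_iff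
    (fun g w hw => not_hasTrivialSL3LieStabilizer_actTensor g w hw) h₀

/-- **One stable tensor makes polystability generic** (Mumford's route to BI 2017 Prop. 4.10): if
some `w₀ ∈ ⊗³ℂ^ι` has a closed `SL³`-orbit and zero traceless infinitesimal stabilizer, then
Zariski-almost all `w ∈ ⊗³ℂ^ι` are polystable — the generic set being `{q ≠ 0}` for the separating
invariant of `exists_isSL3Invariant_ne_zero_of_stable`.
[cite: BurgisserIkenmeyer2017, Prop. 4.10] [cite: MumfordFogartyKirwan1994, Ch. 4 §2 Prop. 4.2] -/
theorem isZariskiGenericTensor_isPolystableTensor_of_exists_stable [Nonempty ι]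
    (h : ∃ w₀ : ι → ι → ι → ℂ, IsPolystableTensor w₀ ∧ HasTrivialSL3LieStabilizer w₀) :
    IsZariskiGenericTensor (IsPolystableTensor : (ι → ι → ι → ℂ) → Prop) := by
  obtain ⟨w₀, hw₀, h₀⟩ := h
  obtain ⟨q, hq, hq0, hqbad⟩ := exists_isSL3Invariant_ne_zero_of_stable hw₀ h₀
  exact isZariskiGenericTensor_isPolystableTensor_of_sl3Invariant hq hq0 hqbad

end OfStable

section Assembly

/-- **BI 2017, Prop. 4.10 from one stable tensor per format** ("Almost all `w ∈ ⊗³ℂ^m` are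
polystable"): given, for every `m ≥ 3`, a polystable `w₀ ∈ ⊗³ℂ^m` with zero traceless
infinitesimal stabilizer, the typed statement `BI2017_prop_4_10` holds for all `m` (`m ≤ 1`:
`isZariskiGenericTensor_isPolystableTensor_of_le_one`; `m = 2`: `BI2017_prop_4_10_two`).
[cite: BurgisserIkenmeyer2017, Prop. 4.10] -/
theorem BI2017_prop_4_10_of_exists_stable
    (h : ∀ m : ℕ, 3 ≤ m → ∃ w₀ : Fin m → Fin m → Fin m → ℂ,
      IsPolystableTensor w₀ ∧ HasTrivialSL3LieStabilizer w₀) :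
    BI2017_prop_4_10 := by
  intro m
  obtain hm | rfl | hm : m ≤ 1 ∨ m = 2 ∨ 3 ≤ m := by omega
  · exact isZariskiGenericTensor_isPolystableTensor_of_le_one hm
  · exact BI2017_prop_4_10_two
  · haveI : Nonempty (Fin m) := ⟨⟨0, by omega⟩⟩
    exact isZariskiGenericTensor_isPolystableTensor_of_exists_stable (h m hm)

/-- The same with the witnesses indexed as `m = n + 3`. [cite: BurgisserIkenmeyer2017, Prop. 4.10] -/
theorem BI2017_prop_4_10_of_exists_stable_add_three
    (h : ∀ n : ℕ, ∃ w₀ : Fin (n + 3) → Fin (n + 3) → Fin (n + 3) → ℂ,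
      IsPolystableTensor w₀ ∧ HasTrivialSL3LieStabilizer w₀) :
    BI2017_prop_4_10 := by
  refine BI2017_prop_4_10_of_exists_stable fun m hm => ?_
  obtain ⟨n, rfl⟩ : ∃ n, m = n + 3 := ⟨m - 3, by omega⟩
  exact h n

/-- **Popov's 1970 stability criterion on `⊗³ℂ^m` (typed form), from one stable tensor per
format**: the typed cite-fact `Popov1970_genericClosedOrbit_tensor` ("`m ≥ 2`: generically finite
stabilizer ⇒ generically closed orbit") follows, its conclusion holding outright by
`BI2017_prop_4_10_of_exists_stable`. [cite: Popov1970, Theorem] [cite: BurgisserIkenmeyer2017, Prop. 4.10 (proof)] -/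
theorem Popov1970_genericClosedOrbit_tensor_of_exists_stable
    (h : ∀ m : ℕ, 3 ≤ m → ∃ w₀ : Fin m → Fin m → Fin m → ℂ,
      IsPolystableTensor w₀ ∧ HasTrivialSL3LieStabilizer w₀) :
    Popov1970_genericClosedOrbit_tensor :=
  fun m _ _ => BI2017_prop_4_10_of_exists_stable h m

/-- **BI 2017, Cor. 5.12 from one stable tensor per format**: through the tree's edge
`BI2017_cor_5_12_of_thm_4_2_of_prop_4_10` with `BI2017_thm_4_2_holds` and
`BI2017_prop_4_10_of_exists_stable`. [cite: BurgisserIkenmeyer2017, Cor. 5.12] -/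
theorem BI2017_cor_5_12_of_exists_stable
    (h : ∀ m : ℕ, 3 ≤ m → ∃ w₀ : Fin m → Fin m → Fin m → ℂ,
      IsPolystableTensor w₀ ∧ HasTrivialSL3LieStabilizer w₀) :
    BI2017_cor_5_12 :=
  BI2017_cor_5_12_of_thm_4_2_of_prop_4_10 BI2017_thm_4_2_holds (BI2017_prop_4_10_of_exists_stable h)

end Assembly

end Literature.Computability.AlgebraicComplexity

end
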